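import Summits.CriticalPhenomena.PercolationContinuityZ3.Theorems.SahiMasterFamilyCoordPolyPeel

/-!
# The fibre polynomial of `E_k` has degree at most the number of `e`-dependent slots; face-vanishing fibres at `r_e ≤ 2`

Unit `prim-masterthm-p4` (gen 11; crux anchor stmt-CriticalPhenomena-4575, helper work; memo
`run/shared/lean/prim/prim-masterthm/prim-masterthm-p4/FACE-QUOTIENT-3.md` §1).  ALL ORDERS.  Along one coordinate `e` of a product measure,
`s ↦ E_k(μ_{p[e↦s]}; F)` is the polynomial `sahiEP (secPoly p e) k F` (tree, `sahiE_update_eq_eval`), of degree `≤ k`.  We sharpen: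

* `natDegree_sahiEP_le_card` (abstract Lieb–Sahi recursion with polynomial moments): if the moment map has degree `≤ 1` in general and degree
  `0` on a multiplicatively closed class of "free" functions, then `deg sahiEP M k F ≤ #{j : F j not free}`;
* `natDegree_sahiEP_secPoly_le_card` — hence `deg_s E_k(μ_{p[e↦s]}; F) ≤ r_e :=` the number of slots whose function does not ignore `e`;
* **`sahiE_update_eq_four_mul_of_card_le_two`** — if at most two slots depend on `e` and both `e`-ends of the fibre vanish
  (`E_k = 0` at `p[e↦0]` and at `p[e↦1]`, e.g. both `e`-minors are zero flags), then for every `s ∈ [0,1]`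
  `E_k(μ_{p[e↦s]}; F) = 4 s(1−s) · E_k(μ_{p[e↦½]}; F)`: on such a fibre `E_k / (p_e(1−p_e))` is CONSTANT (the `r_e = 2` companion of the
  order-3 `FibreCubic`; at `r_e = 2` coordinates of the (EQI-4) endgame this constant is prim-master-conj's detector `Ψ`).
HONEST FRAMING: structural identities; no positivity claim. [this work]
-/

noncomputable section

open scoped Classical

namespace Summit.CriticalPhenomena.PercolationContinuityZ3.Theorems

open Finset Function Polynomial
open Literature.Combinatorics.Sahi2008

/-! ### Abstract degree bound by the number of non-free slots -/

section Abstract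

variable {α : Type*} (M : (α → ℝ) → ℝ[X]) (free : (α → ℝ) → Prop)

/-- The number of slots of `F` whose function is not `free` (as a sum of indicators). [this work] -/
def nonFreeCount {n : ℕ} (F : Fin n → α → ℝ) : ℕ := ∑ j, if free (F j) then 0 else 1

omit M in
/-- Peeling the head: `#nonfree(F) = #nonfree(tail F) + [F 0 not free]`. [this work] -/
theorem nonFreeCount_succ {n : ℕ} (F : Fin (n + 1) → α → ℝ) :
    nonFreeCount free F = nonFreeCount free (Fin.tail F) + (if free (F 0) then 0 else 1) := by
  unfold nonFreeCount
  rw [Fin.sum_univ_succ, add_comm]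
  rfl

omit M in
/-- A family with a non-free slot has positive count. [this work] -/
theorem one_le_nonFreeCount {n : ℕ} (F : Fin n → α → ℝ) (i : Fin n) (hi : ¬ free (F i)) : 1 ≤ nonFreeCount free F := by
  unfold nonFreeCount
  have := Finset.single_le_sum (f := fun j => if free (F j) then 0 else 1) (fun j _ => Nat.zero_le _) (Finset.mem_univ i)
  simpa [hi] using this

omit M in
/-- Updating a slot by a product with a free head does not increase the non-free count; with a non-free head it increases it by at most one.
[this work] -/
theorem nonFreeCount_update_mul_le (hmul : ∀ g h, free g → free h → free (g * h)) {n : ℕ} (G : Fin n → α → ℝ) (i : Fin n)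
    (f : α → ℝ) : nonFreeCount free (update G i (G i * f)) ≤ nonFreeCount free G + (if free f then 0 else 1) := by
  unfold nonFreeCount
  have key : ∀ j, (if free (update G i (G i * f) j) then 0 else 1) ≤
      (if free (G j) then 0 else 1) + (if j = i then (if free f then 0 else 1) else 0) := by
    intro j
    by_cases hji : j = i
    · subst hji
      rw [update_self, if_pos rfl]
      by_cases hG : free (G j) <;> by_cases hf : free f <;> simp [hG, hf, hmul] <;> split_ifs <;> omega
    · rw [update_of_ne hji, if_neg hji, add_zero]
  refine (Finset.sum_le_sum fun j _ => key j).trans ?_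
  rw [Finset.sum_add_distrib, Finset.sum_ite_eq' univ i, if_pos (mem_univ i)]

/-- **Degree bound by the number of non-free slots.**  If every moment `M h` has degree `≤ 1`, free functions have constant moments
(`deg M h = 0`), and free functions are closed under products, then `deg (sahiEP M n F) ≤ #{j : ¬ free (F j)}`. [this work] -/
theorem natDegree_sahiEP_le_card (hM : ∀ h, (M h).natDegree ≤ 1) (hfree : ∀ h, free h → (M h).natDegree = 0)
    (hmul : ∀ g h, free g → free h → free (g * h)) :
    ∀ (n : ℕ) (F : Fin n → α → ℝ), (sahiEP M n F).natDegree ≤ nonFreeCount free F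
  | 0, F => by simp [sahiEP]
  | 1, F => by
    rw [sahiEP]
    by_cases h : free (F 0)
    · rw [hfree _ h]; exact Nat.zero_le _
    · exact (hM _).trans (one_le_nonFreeCount free F 0 h)
  | n + 2, F => by
    rw [sahiEP]
    have htail := nonFreeCount_succ free F
    refine (natDegree_sub_le _ _).trans (max_le ?_ ?_)
    · refine Polynomial.natDegree_sum_le_of_forall_le _ _ fun i _ => ?_
      refine (natDegree_sahiEP_le_card hM hfree hmul (n + 1) _).trans ?_
      refine (nonFreeCount_update_mul_le free hmul (Fin.tail F) i (F 0)).trans ?_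
      rw [htail]
    · refine natDegree_mul_le.trans ?_
      rw [htail]
      refine add_le_add (natDegree_sahiEP_le_card hM hfree hmul (n + 1) _) ?_
      by_cases h : free (F 0)
      · rw [if_pos h, hfree _ h]
      · rw [if_neg h]; exact hM _

end Abstract

/-! ### One coordinate of a product measure -/

section Bernoulli

variable {ι : Type*} [Fintype ι]

/-- **Degree of the fibre polynomial ≤ number of `e`-dependent slots** (`r_e`). [this work] -/
theorem natDegree_sahiEP_secPoly_le_card (p : ι → unitInterval) (e : ι) (n : ℕ) (F : Fin n → Set ι → ℝ) :
    (sahiEP (secPoly p e) n F).natDegree ≤ nonFreeCount (fun h : Set ι → ℝ => ∀ ω, h (insert e ω) = h ω) F :=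
  natDegree_sahiEP_le_card (secPoly p e) (fun h : Set ι → ℝ => ∀ ω, h (insert e ω) = h ω) (natDegree_secPoly_le p e)
    (fun h hh => by rw [secPoly_eq_C_of_ignores p e hh, natDegree_C]) (fun _ _ hg hh => mul_ignores hg hh) n F

/-- A real polynomial of degree `≤ 2` vanishing at `0` and `1` is `c · X(1 − X)`: its values satisfy `P(s) = 4 s (1−s) P(½)`. [folklore] -/
theorem eval_eq_four_mul_of_natDegree_le_two (P : ℝ[X]) (hdeg : P.natDegree ≤ 2) (h0 : P.eval 0 = 0) (h1 : P.eval 1 = 0) (s : ℝ) :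
    P.eval s = 4 * s * (1 - s) * P.eval (1 / 2) := by
  have hexp : ∀ x : ℝ, P.eval x = P.coeff 0 + P.coeff 1 * x + P.coeff 2 * x ^ 2 := by
    intro x
    rw [eval_eq_sum_range' (n := 3) (by omega)]
    simp only [sum_range_succ, sum_range_zero, zero_add, pow_zero, mul_one, pow_one]
  have e0 := hexp 0
  have e1 := hexp 1
  rw [h0] at e0
  rw [h1] at e1
  simp only [mul_zero, zero_pow (two_ne_zero), add_zero] at e0
  rw [hexp s, hexp (1 / 2)]
  have hc0 : P.coeff 0 = 0 := e0.symm
  have hc2 : P.coeff 2 = -P.coeff 1 := by rw [hc0] at e1; linarith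
  rw [hc0, hc2]
  ring

/-- **Face-vanishing fibre at a coordinate with at most two dependent slots, every order.**  If at most two of the functions `F j`
depend on `e`, and `E_n(μ_{p[e↦0]}; F) = 0 = E_n(μ_{p[e↦1]}; F)`, then for every `s ∈ [0,1]`:
`E_n(μ_{p[e↦s]}; F) = 4 s (1−s) · E_n(μ_{p[e↦½]}; F)` — the face quotient `E_n/(p_e(1−p_e))` is constant along the fibre. [this work] -/
theorem sahiE_update_eq_four_mul_of_card_le_two (p : ι → unitInterval) (e : ι) (n : ℕ) (F : Fin n → Set ι → ℝ)
    (hcard : nonFreeCount (fun h : Set ι → ℝ => ∀ ω, h (insert e ω) = h ω) F ≤ 2)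
    (h0 : sahiE (bernoulliWeight (update p e 0)) n F = 0) (h1 : sahiE (bernoulliWeight (update p e 1)) n F = 0)
    (s : unitInterval) :
    sahiE (bernoulliWeight (update p e s)) n F =
      4 * (s : ℝ) * (1 - (s : ℝ)) * sahiE (bernoulliWeight (update p e ⟨1 / 2, by norm_num, by norm_num⟩)) n F := by
  rw [sahiE_update_eq_eval, sahiE_update_eq_eval]
  have hdeg := (natDegree_sahiEP_secPoly_le_card p e n F).trans hcard
  have h0' : (sahiEP (secPoly p e) n F).eval 0 = 0 := by
    have := sahiE_update_eq_eval p e 0 n F; rw [h0] at this; simpa using this.symm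
  have h1' : (sahiEP (secPoly p e) n F).eval 1 = 0 := by
    have := sahiE_update_eq_eval p e 1 n F; rw [h1] at this; simpa using this.symm
  exact eval_eq_four_mul_of_natDegree_le_two _ hdeg h0' h1' (s : ℝ)

/-- **Sign constancy on such a fibre**: under the same hypotheses, `E_n(μ_{p[e↦s]}; F)` has the sign of `E_n(μ_{p[e↦½]}; F)` at every
interior `s`, and vanishes for all `s` iff it vanishes at `s = ½`. [this work] -/
theorem sahiE_update_pos_iff_of_card_le_two (p : ι → unitInterval) (e : ι) (n : ℕ) (F : Fin n → Set ι → ℝ)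
    (hcard : nonFreeCount (fun h : Set ι → ℝ => ∀ ω, h (insert e ω) = h ω) F ≤ 2)
    (h0 : sahiE (bernoulliWeight (update p e 0)) n F = 0) (h1 : sahiE (bernoulliWeight (update p e 1)) n F = 0)
    {s : unitInterval} (hs : (s : ℝ) ∈ Set.Ioo (0 : ℝ) 1) :
    0 < sahiE (bernoulliWeight (update p e s)) n F ↔
      0 < sahiE (bernoulliWeight (update p e ⟨1 / 2, by norm_num, by norm_num⟩)) n F := by
  rw [sahiE_update_eq_four_mul_of_card_le_two p e n F hcard h0 h1 s]
  have hpos : 0 < 4 * (s : ℝ) * (1 - (s : ℝ)) := by nlinarith [hs.1, hs.2]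
  constructor
  · intro h; by_contra hle; push Not at hle
    have := mul_nonpos_of_nonneg_of_nonpos hpos.le hle
    linarith
  · intro h; exact mul_pos hpos h

end Bernoulli

end Summit.CriticalPhenomena.PercolationContinuityZ3.Theorems
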